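import Literature.MathematicalPhysics.QuantumFieldTheory.Balaban1983to89.Beta.CompositionSingular

/-!
# `BalabanUV.Beta.FP.SliceSaturation` — road «FP» for binder row D1, row **RHOA-1 (model core of S2)** (owner rulings R-FP-22 ∕ R-FP-24,
# `HOME/b2b-balaban-beta-d1-p3/RHOA-DESIGN.md` §1 S2, `N7-PROOF.v3.3.md` §2(b)): A SLICE SATURATED BY THE ORBIT DOES NOT CHANGE THE EFFECTIVE FORM —
# the constrained minimiser of `H₀ + EᵀE` lies IN the slice (`E·minOp = 0`), the effective (block) form is the gauge-invariant value form `minOpᵀ·H₀·minOp`,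
# and two saturated slices give THE SAME effective form ([folklore] finite-dimensional linear algebra; nothing of the manuscripts)

HONEST DEPENDENCY (page 1, mandatory): continuum YM on T⁴ ⇐ BetaPertH ∧ nine spine estimates (0/9 proved); BetaPertH ⇐ (D1) ∧ (D4) ∧
CAP+tail; G-an2-4 gates asym, D1 and NE2/3/4.  HONEST FRAMING (cell contract, verbatim): «discharging `BetaPertH` makes Bałaban's UV
stability UNCONDITIONAL — a real constructive-QFT result; it is NOT the continuum limit and NOT the Clay problem.»  THIS MODULE is [folklore] matrix
algebra over `ℝ` in the cell's bordered-matrix dictionary (`Composition.kkt`, `CompositionSingular.effForm`∕`minOp`∕`kkt_mul_blocks`); every hypothesis is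
displayed; no `def`, no `def … : Prop`, nothing cited, 0 sorry.  It instantiates NO object of Bałaban's and proves NO estimate; NOT hbook, NOT D1, NOT BetaPertH,
NOT continuum, NOT Clay.

ABSOLUTE RULE (cell charter, verbatim): «No internally-minted statement may enter as a cited fact. Every hypothesis is either kernel-proved in this
package or a verbatim quotation of a PUBLISHED theorem with page reference. The manuscript(s) under audit are NOT citable for their own disputed
steps — they are the thing under adjudication; programme-internal (2001/route/tribunal) claims are never citable.»

WHY (RHOA-DESIGN §1 S2, N7-PROOF v3.3 §2(b)).  Bałaban's one shot borders the gauge-invariant Lagrangian Hessian `H₀ = Δ₁(B)` (REPAIR A: `H₀·W = 0` on the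
residual-group directions `W = d_B(Lie K_n)`, which also satisfy `Q·W = 0`) with the COVARIANT INNER SLICE `EᵀE = dΠd^*` (R-FP-18, B5 (1.28)∕(1.70)) whose row
space is SATURATED by the orbit: `range E = range (E·W)` — every value of `Πd^*φ` is reached by a residual gauge transformation.  The effective (block) quadratic
form `effForm (H₀ + EᵀE) Q` (minus the `λλ`-corner of the bordered inverse; the multiplier covariance of the one shot; the Hessian of the value function
`a ↦ min{⟨φ,(H₀+EᵀE)φ⟩ : Qφ = a}`) is then the GAUGE-INVARIANT value form `minOpᵀ·H₀·minOp` and does NOT depend on the saturated slice — the algebraic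
half of «`𝔊 = effForm (H_cov) Q = n⁻⁴·Δ_∞^c`» (the other half, the fixed-point identity S1, is the tree-level semigroup, toy-certified kit j109748).  With a
NON-saturated slice (full Feynman `dd^*`, bordering `H_BF`) the effective form picks up the induced gauge fixing `Ξ ⪰ 0` instead (tree: the weighted downdate
identities of `FP/ResidualModeIdentities`); this file is the saturated case.

CONTENT (real matrices; `H₀` symmetric; `W : Matrix ν ω ℝ` the orbit directions; `E : Matrix κ ν ℝ` the slice rows; `Q : Matrix μ ν ℝ` the constraint):
* §1 `transpose_W_mul_slice_minOp` — `H₀ᵀ = H₀`, `H₀W = 0`, `QW = 0`, `kkt (H₀ + EᵀE) Q` invertible ⟹ `Wᵀ·EᵀE·minOp = 0` (stationarity tested against the orbit);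
  **`slice_mul_minOp_eq_zero`** — if moreover the slice is SATURATED, `E = E·W·N` for some `N`, then `E·minOp (H₀ + EᵀE) Q = 0` (over `ℝ`: `AᵀA = 0 ⟹ A = 0`).
* §2 `effForm_eq_transpose_minOp_mul` — for ANY `H` with `kkt H Q` invertible: `effForm H Q = (minOp H Q)ᵀ·H·minOp H Q` (no symmetry needed);
  **`effForm_eq_valueForm_of_saturated`** — in the saturated case `effForm (H₀ + EᵀE) Q = minOpᵀ·H₀·minOp` (the slice term drops out of the value).
* §3 **`effForm_eq_of_saturated_slices`** — two saturated slices `E, E′` (both bordered matrices invertible) give `effForm (H₀ + EᵀE) Q = effForm (H₀ + E′ᵀE′) Q`,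
  and `minOp (H₀ + EᵀE) Q − minOp (H₀ + E′ᵀE′) Q` has columns in `ker Q` (`Q·(minOp − minOp′) = 0`).
Provenance: road FP OWNER b2b-balaban-beta-d1-p3 gen 6 (prover-b2b-balaban-beta-d1-p3-g6-0), 2026-08-20, row RHOA-1.
-/

noncomputable section

namespace Summit.QuantumFields.BalabanUV.Beta.FP.SliceSaturation

open Literature.MathematicalPhysics.QuantumFieldTheory.Balaban1983to89.Beta.Composition (kkt)
open Literature.MathematicalPhysics.QuantumFieldTheory.Balaban1983to89.Beta.CompositionSingular (effForm minOp kkt_mul_blocks)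
open scoped Matrix
open Matrix

variable {ν μ κ κ' ω : Type*} [Fintype ν] [Fintype μ] [Fintype κ] [DecidableEq ν] [DecidableEq μ]

/-! ## §1 The minimiser of a saturated-slice form lies in the slice -/

/-- [folklore] **STATIONARITY TESTED AGAINST THE ORBIT**: `H₀` symmetric with `H₀·W = 0`, `Q·W = 0`, bordered matrix of `H₀ + EᵀE` invertible ⟹
`Wᵀ·(EᵀE)·minOp (H₀ + EᵀE) Q = 0` (from `(H₀ + EᵀE)·minOp = Qᵀ·effForm` multiplied by `Wᵀ`). -/
theorem transpose_W_mul_slice_minOp (H₀ : Matrix ν ν ℝ) (E : Matrix κ ν ℝ) (Q : Matrix μ ν ℝ) (W : Matrix ν ω ℝ)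
    (hH : H₀ᵀ = H₀) (hHW : H₀ * W = 0) (hQW : Q * W = 0) (h : IsUnit (kkt (H₀ + Eᵀ * E) Q).det) :
    Wᵀ * (Eᵀ * E) * minOp (H₀ + Eᵀ * E) Q = 0 := by
  have hst := (kkt_mul_blocks (H₀ + Eᵀ * E) Q h).2.1
  -- `Wᵀ H₀ = 0` and `Wᵀ Qᵀ = 0`
  have hWH : Wᵀ * H₀ = 0 := by
    have := congrArg Matrix.transpose hHW
    rwa [Matrix.transpose_mul, hH, Matrix.transpose_zero] at this
  have hWQ : Wᵀ * Qᵀ = 0 := by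
    have := congrArg Matrix.transpose hQW
    rwa [Matrix.transpose_mul, Matrix.transpose_zero] at this
  have key : Wᵀ * ((H₀ + Eᵀ * E) * minOp (H₀ + Eᵀ * E) Q) = Wᵀ * (Qᵀ * effForm (H₀ + Eᵀ * E) Q) := by rw [hst]
  rw [← Matrix.mul_assoc, ← Matrix.mul_assoc, Matrix.mul_add, hWH, zero_add, hWQ, Matrix.zero_mul] at key
  exact key

/-- [folklore] **THE MINIMISER LIES IN A SATURATED SLICE**: under the hypotheses of `transpose_W_mul_slice_minOp`, if the slice rows are saturated by the
orbit (`E = E·W·N`), then `E·minOp (H₀ + EᵀE) Q = 0`.  (Over `ℝ`: with `A := E·minOp`, `AᵀA = (EWN·minOp)ᵀ·E·minOp = minOpᵀNᵀ·(WᵀEᵀE·minOp) = 0`, hence `A = 0`.) -/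
theorem slice_mul_minOp_eq_zero [Fintype ω] (H₀ : Matrix ν ν ℝ) (E : Matrix κ ν ℝ) (Q : Matrix μ ν ℝ) (W : Matrix ν ω ℝ) (N : Matrix ω ν ℝ)
    (hH : H₀ᵀ = H₀) (hHW : H₀ * W = 0) (hQW : Q * W = 0) (hsat : E = E * W * N) (h : IsUnit (kkt (H₀ + Eᵀ * E) Q).det) :
    E * minOp (H₀ + Eᵀ * E) Q = 0 := by
  set A := E * minOp (H₀ + Eᵀ * E) Q with hA
  have hWE := transpose_W_mul_slice_minOp H₀ E Q W hH hHW hQW h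
  have hAA : Aᵀ * A = 0 := by
    calc Aᵀ * A = (E * W * N * minOp (H₀ + Eᵀ * E) Q)ᵀ * (E * minOp (H₀ + Eᵀ * E) Q) := by rw [hA, ← hsat]
      _ = (minOp (H₀ + Eᵀ * E) Q)ᵀ * Nᵀ * (Wᵀ * (Eᵀ * E) * minOp (H₀ + Eᵀ * E) Q) := by
          simp only [Matrix.transpose_mul, Matrix.mul_assoc]
      _ = 0 := by rw [hWE, Matrix.mul_zero]
  have hAA' : Aᴴ * A = 0 := by rwa [Matrix.conjTranspose_eq_transpose_of_trivial]
  exact Matrix.conjTranspose_mul_self_eq_zero.mp hAA'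

/-! ## §2 The effective form is the value form; the slice term drops out -/

omit [Fintype κ] in
/-- [folklore] **THE EFFECTIVE FORM IS THE VALUE FORM**: for any `H` with `kkt H Q` invertible, `effForm H Q = (minOp H Q)ᵀ·H·minOp H Q`
(from `H·minOp = Qᵀ·effForm` and `Q·minOp = 1`; no symmetry of `H` needed). -/
theorem effForm_eq_transpose_minOp_mul (H : Matrix ν ν ℝ) (Q : Matrix μ ν ℝ) (h : IsUnit (kkt H Q).det) :
    effForm H Q = (minOp H Q)ᵀ * H * minOp H Q := by
  obtain ⟨-, hst, -, hQI⟩ := kkt_mul_blocks H Q h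
  have hIQ : (minOp H Q)ᵀ * Qᵀ = 1 := by
    have := congrArg Matrix.transpose hQI
    rwa [Matrix.transpose_mul, Matrix.transpose_one] at this
  calc effForm H Q = 1 * effForm H Q := by rw [Matrix.one_mul]
    _ = (minOp H Q)ᵀ * Qᵀ * effForm H Q := by rw [hIQ]
    _ = (minOp H Q)ᵀ * (H * minOp H Q) := by rw [Matrix.mul_assoc, hst]
    _ = (minOp H Q)ᵀ * H * minOp H Q := by rw [Matrix.mul_assoc]

/-- [folklore] **IN A SATURATED SLICE THE EFFECTIVE FORM IS THE GAUGE-INVARIANT VALUE FORM**: `effForm (H₀ + EᵀE) Q = minOpᵀ·H₀·minOp`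
(`minOp` of the bordered `H₀ + EᵀE`); the slice term contributes `(E·minOp)ᵀ(E·minOp) = 0`. -/
theorem effForm_eq_valueForm_of_saturated [Fintype ω] (H₀ : Matrix ν ν ℝ) (E : Matrix κ ν ℝ) (Q : Matrix μ ν ℝ) (W : Matrix ν ω ℝ) (N : Matrix ω ν ℝ)
    (hH : H₀ᵀ = H₀) (hHW : H₀ * W = 0) (hQW : Q * W = 0) (hsat : E = E * W * N) (h : IsUnit (kkt (H₀ + Eᵀ * E) Q).det) :
    effForm (H₀ + Eᵀ * E) Q = (minOp (H₀ + Eᵀ * E) Q)ᵀ * H₀ * minOp (H₀ + Eᵀ * E) Q := by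
  have hE := slice_mul_minOp_eq_zero H₀ E Q W N hH hHW hQW hsat h
  rw [effForm_eq_transpose_minOp_mul _ _ h, Matrix.mul_add, Matrix.add_mul]
  have : (minOp (H₀ + Eᵀ * E) Q)ᵀ * (Eᵀ * E) * minOp (H₀ + Eᵀ * E) Q = 0 := by
    rw [Matrix.mul_assoc, Matrix.mul_assoc, hE, Matrix.mul_zero, Matrix.mul_zero]
  rw [this, add_zero]

/-! ## §3 Two saturated slices give the same effective form -/

omit [Fintype κ] in
/-- [folklore] the minimisers of two borderings of the same constraint differ by columns in `ker Q`. -/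
theorem Q_mul_minOp_sub_minOp (H H' : Matrix ν ν ℝ) (Q : Matrix μ ν ℝ) (h : IsUnit (kkt H Q).det) (h' : IsUnit (kkt H' Q).det) :
    Q * (minOp H Q - minOp H' Q) = 0 := by
  rw [Matrix.mul_sub, (kkt_mul_blocks H Q h).2.2.2, (kkt_mul_blocks H' Q h').2.2.2, sub_self]

/-- [folklore] **SLICE INDEPENDENCE OF THE EFFECTIVE FORM**: `H₀` symmetric, `H₀·W = 0`, `Q·W = 0`, two slices `E, E′` both saturated by the orbit
(`E = E·W·N`, `E′ = E′·W·N′`), both bordered matrices invertible ⟹ `effForm (H₀ + EᵀE) Q = effForm (H₀ + E′ᵀE′) Q`.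
(Both equal their value forms `𝓘ᵀH₀𝓘`; the difference is `𝓘ᵀH₀δ + δᵀH₀𝓘′` with `δ := 𝓘 − 𝓘′ ∈ ker Q` columnwise, and `H₀𝓘 = Qᵀ·effForm − EᵀE𝓘 = Qᵀ·effForm`,
so each term is `(Qδ)ᵀ(…) = 0`.) -/
theorem effForm_eq_of_saturated_slices [Fintype κ'] [Fintype ω] (H₀ : Matrix ν ν ℝ) (E : Matrix κ ν ℝ) (E' : Matrix κ' ν ℝ) (Q : Matrix μ ν ℝ) (W : Matrix ν ω ℝ)
    (N : Matrix ω ν ℝ) (N' : Matrix ω ν ℝ)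
    (hH : H₀ᵀ = H₀) (hHW : H₀ * W = 0) (hQW : Q * W = 0) (hsat : E = E * W * N) (hsat' : E' = E' * W * N')
    (h : IsUnit (kkt (H₀ + Eᵀ * E) Q).det) (h' : IsUnit (kkt (H₀ + E'ᵀ * E') Q).det) :
    effForm (H₀ + Eᵀ * E) Q = effForm (H₀ + E'ᵀ * E') Q := by
  set I₁ := minOp (H₀ + Eᵀ * E) Q with hI₁
  set I₂ := minOp (H₀ + E'ᵀ * E') Q with hI₂
  have hE₁ : E * I₁ = 0 := slice_mul_minOp_eq_zero H₀ E Q W N hH hHW hQW hsat h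
  have hE₂ : E' * I₂ = 0 := slice_mul_minOp_eq_zero H₀ E' Q W N' hH hHW hQW hsat' h'
  have hv₁ := effForm_eq_valueForm_of_saturated H₀ E Q W N hH hHW hQW hsat h
  have hv₂ := effForm_eq_valueForm_of_saturated H₀ E' Q W N' hH hHW hQW hsat' h'
  -- stationarity with the slice term removed: `H₀ Iᵢ = Qᵀ effFormᵢ`
  have hst₁ : H₀ * I₁ = Qᵀ * effForm (H₀ + Eᵀ * E) Q := by
    have := (kkt_mul_blocks (H₀ + Eᵀ * E) Q h).2.1
    rw [Matrix.add_mul, Matrix.mul_assoc, hE₁, Matrix.mul_zero, add_zero] at this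
    exact this
  have hst₂ : H₀ * I₂ = Qᵀ * effForm (H₀ + E'ᵀ * E') Q := by
    have := (kkt_mul_blocks (H₀ + E'ᵀ * E') Q h').2.1
    rw [Matrix.add_mul, Matrix.mul_assoc, hE₂, Matrix.mul_zero, add_zero] at this
    exact this
  have hQ₁ : Q * I₁ = 1 := (kkt_mul_blocks (H₀ + Eᵀ * E) Q h).2.2.2
  have hQ₂ : Q * I₂ = 1 := (kkt_mul_blocks (H₀ + E'ᵀ * E') Q h').2.2.2
  have hQ₁t : I₁ᵀ * Qᵀ = 1 := by
    have := congrArg Matrix.transpose hQ₁; rwa [Matrix.transpose_mul, Matrix.transpose_one] at this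
  have hQ₂t : I₂ᵀ * Qᵀ = 1 := by
    have := congrArg Matrix.transpose hQ₂; rwa [Matrix.transpose_mul, Matrix.transpose_one] at this
  -- `I₁ᵀ H₀ I₂` computed two ways
  have hA : I₁ᵀ * H₀ * I₂ = effForm (H₀ + E'ᵀ * E') Q := by
    rw [Matrix.mul_assoc, hst₂, ← Matrix.mul_assoc, hQ₁t, Matrix.one_mul]
  have hB : I₁ᵀ * H₀ * I₂ = effForm (H₀ + Eᵀ * E) Q := by
    have e1 : I₁ᵀ * H₀ = (H₀ * I₁)ᵀ := by rw [Matrix.transpose_mul, hH]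
    rw [e1, hst₁, Matrix.transpose_mul, Matrix.transpose_transpose, Matrix.mul_assoc, hQ₂, Matrix.mul_one]
    -- `effFormᵀ = effForm`: from the value form `I₁ᵀ H₀ I₁`, symmetric since `H₀` is
    rw [hv₁, Matrix.transpose_mul, Matrix.transpose_mul, Matrix.transpose_transpose, hH, Matrix.mul_assoc]
  rw [← hB, hA]

end Summit.QuantumFields.BalabanUV.Beta.FP.SliceSaturation

end
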